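import Summits.BirchSwinnertonDyer.BirchSwinnertonDyer.Theorems.GenusKolyvaginAtTwoMinimalTwinBSDTwoOddCutOfTranspositionWitness
import Summits.BirchSwinnertonDyer.BirchSwinnertonDyer.Theorems.GenusKolyvaginAtTwoMinimalTwinBSDTwoSwappedPairSandwich
import HarnessLib

/-!
# Route `GenusKolyvaginAtTwo`, crux U₂ `MinimalTwinBSDTwo` (stmt-BirchSwinnertonDyer-22985), LINE 23 «twin_swap» — NECESSITY OF THE DEPTH-ZERO BIT AT
# DOOR-OPEN FRAMES: `BSD₂(W) ∧ BSD₂(Wd)` force `y_K ∉ 2W(K[1])` at every door-open budget frame with an odd-`c` datum (so FRAME♮'s door-open disjunct is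
# TIGHT, and a door-open budget frame of positive depth would REFUTE BSD₂ for the pair)

Seat `bsd-line-gk2-p2` g32 (PROVER seat 2/3, cell `bsd-f1-sign2`, LINE 23 holder), `--supports stmt-BirchSwinnertonDyer-22985 --as helper`.
THEOREMS ONLY (no definition, no named fact, no `sorry`).  BSD is NOT proved by any of this; U₂ is NOT proved; nothing is closed.

WHY.  v2.9's analytic leaf FRAME♮ asks, at a door-OPEN budget frame (`#Sel₂(Wd) = 1`), for the classical `2`-primitivity bit `y_K ∉ 2W(K[1])` (depth `0`);
p814255 showed the bit is NECESSARY for the Kolyvagin road (no deep witness at positive depth there).  Here: it is necessary for BSD itself.  g27's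
LOSSLESS descent `AnalyticTwin.natCard_sha_mul_eq_of_bsdp_anyTwin` (BSD₂(W) ∧ BSD₂(Wd) + PRINT ⟹ `#Ш(W_K)[2^∞]·2^{2(ord₂c+ord₂C(W))} = 2^{2M₀}`) and
g23's sandwich `finite_and_natCard_primaryComponent_sha_baseChange_two_eq_one_of_swappedPair` (door open in budget ⟹ `#Ш(W_K)[2^∞] = 1`) give
`2^{2 ord₂ c} = 2^{2M₀}` when `C(W)` is odd, i.e. **`M₀ = ord₂ c`**, and `M₀ = 0` for an odd-`c` datum.  NO Q2, NO habitat (no multiplicative prime, only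
`ρ̄_{W,2}` onto), NO sign of `Δ`.
* §1 `depth_eq_zero_of_doorOpen_of_bsdp_pair` — the necessity (mod GZ + GZK + modularity + Milne).
* §2 `not_bsdp_pair_of_doorOpen_of_one_le_depth` — contrapositive: a door-open budget frame with odd `c`, `C(W)` odd and depth `≥ 1` refutes
  `BSD₂(W) ∧ BSD₂(Wd)` — a BSD-falsifier SHAPE for refuters and -data seats (compute `y_K mod 2W(K)` at door-open prime frames of U₂-cell curves).

References: [GrossZagier1986] V.§2 (2.2); [Milne1972ArithmeticAV] §1 Thm. 1; [MazurRubin2010] Cor. 3.4 (i); [Kramer1981] Thm. 1.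
-/

set_option autoImplicit false
set_option linter.dupNamespace false -- `Summit.<P>.<Sub>` repeats `BirchSwinnertonDyer` (D-0017)

noncomputable section

open scoped Classical

namespace Summit.BirchSwinnertonDyer.BirchSwinnertonDyer.Theorems.GenusExact.TwinSwap.TwinAnnihilation

open Literature.NumberTheory.EllipticCurves Literature.NumberTheory.GaloisRepresentations WeierstrassCurve NumberField
  IsDedekindDomain Field AddSubgroup Literature.NumberTheory.EllipticCurves.ModularForms
open Summit.BirchSwinnertonDyer.Rank1Residual
open Summit.BirchSwinnertonDyer.BirchSwinnertonDyer.Theorems.GenusExact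

/-! ## §1 Door open + BSD₂ for the pair ⟹ depth zero -/

/-- **At a DOOR-OPEN budget frame, `BSD₂(W) ∧ BSD₂(Wd)` force exact depth `M₀ = 0`** (`W` globally minimal, `r_an(W) = 1`, `#Sel₂(W) = 2`, `C(W)` odd,
`ρ̄_{W,2}` onto; `K` odd `d_K ≠ −3` Heegner; `Dt` with `Dt.c` odd; `P(1)` non-torsion of exact depth `M₀`; `Wd ≅ W^{(d_K)}` globally minimal with
`#Sel₂(Wd) = 1` inside the genus budget): g27's lossless descent gives `#Ш(W_K)[2^∞]·2^{2(ord₂c+ord₂C(W))} = 2^{2M₀}`, g23's sandwich gives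
`#Ш(W_K)[2^∞] = 1`, and `ord₂ c = ord₂ C(W) = 0`.  CONDITIONAL on GZ + GZK + modularity + Milne and the two `BSD₂` hypotheses; NO Q2, NO habitat, NO
sign of `Δ`; nothing about BSD is proved. [cite: GrossZagier1986, V.§2 (2.2)] [cite: Milne1972ArithmeticAV, §1 Thm. 1] [cite: MazurRubin2010, Cor. 3.4 (i)] -/
theorem depth_eq_zero_of_doorOpen_of_bsdp_pair
    (hGZ : ∀ (N : ℕ) [NeZero N] (W : WeierstrassCurve ℚ) (K : Type) [Field K] [NumberField K], gross_zagier N W K)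
    (hGZK : rank_eq_analyticRank_of_analyticRank_le_one) (hmod : hasEntireLFunction_rat)
    (hMilneC : Milne1972.bsdQuotient_baseChange_quadratic_anyModel)
    (W : WeierstrassCurve ℚ) [W.IsElliptic] [W.IsGloballyMinimal] [NeZero (W.conductorNorm ℤ)]
    (hr : W.analyticRank = 1) (hSel : Nat.card (W.selmerGroup 2) = 2) (hT : Odd W.tamagawaProduct) (hs2 : W.HasSurjectiveModNGaloisRep 2)
    (K : Type) [Field K] [NumberField K] (hK : IsImaginaryQuadratic K) (hodd : Odd (NumberField.discr K))
    (h3 : NumberField.discr K ≠ -3) (hH : SatisfiesHeegnerHypothesis (W.conductorNorm ℤ) K)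
    (Dt : ModularParametrizationData W (W.conductorNorm ℤ)) (hc : Odd Dt.c) (β : ℤ) (ι : K →+* ℂ) (d₁ : KolyvaginHeegnerData Dt β ι 1)
    (hy : ¬ IsOfFinAddOrder d₁.derivedPoint) (M₀ : ℕ)
    (hdiv : ∃ Q : (W.baseChange (ringClassField K ι 1)).toAffine.Point, ((2 ^ M₀ : ℕ) : ℤ) • Q = d₁.derivedPoint)
    (hndiv : ¬ ∃ Q : (W.baseChange (ringClassField K ι 1)).toAffine.Point, ((2 ^ (M₀ + 1) : ℕ) : ℤ) • Q = d₁.derivedPoint)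
    (Wd : WeierstrassCurve ℚ) [Wd.IsElliptic] [Wd.IsGloballyMinimal] (Cd : VariableChange ℚ)
    (hWd : Cd • W.quadraticTwist (NumberField.discr K : ℚ) = Wd) (hSel1 : Nat.card (Wd.selmerGroup 2) = 1)
    (hbudget : (W.Δ < 0 ∧ padicValNat 2 Wd.tamagawaProduct ≤ 1) ∨ padicValNat 2 Wd.tamagawaProduct = 0)
    (hBW : BSDp W 2) (hBd : BSDp Wd 2) : M₀ = 0 := by
  haveI : Fact (Nat.Prime 2) := ⟨Nat.prime_two⟩
  have hc0 : Dt.c ≠ 0 := by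
    obtain ⟨k, hk⟩ := hc
    omega
  -- exactness from BSD₂ of the pair (g27, lossless)
  have hexact := AnalyticTwin.natCard_sha_mul_eq_of_bsdp_anyTwin W K (hGZ _ W K) hGZK hmod hMilneC hr hSel hK hodd h3 hH Dt hc0 β ι d₁ hy hdiv
    hndiv Wd ⟨Cd, hWd⟩ hBW hBd
  -- `#Ш(W_K)[2^∞] = 1` at a door-open frame (g23)
  have h2 : Module.finrank ℚ K = 2 := hK.1
  have h2K : ∀ P : (W.baseChange K).toAffine.Point, (2 : ℤ) • P = 0 → P = 0 := fun P hP ↦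
    EigenClassesFinite.forall_zsmul_two_pow_baseChange_eq_zero_of_hasSurjectiveModNGaloisRep_two W K h2 hs2 1 P (by simpa using hP)
  have hrk : 1 ≤ W.mordellWeilRank := by
    have h := (hGZK W (by rw [hr])).1
    rw [h, hr]
  obtain ⟨-, hone⟩ := finite_and_natCard_primaryComponent_sha_baseChange_two_eq_one_of_swappedPair W K hT hK hodd hH h2K hrk hSel Cd hWd hSel1
    hbudget
  have hc2 : padicValInt 2 Dt.c = 0 :=
    padicValInt.eq_zero_of_not_dvd fun h ↦ (Int.not_even_iff_odd.mpr hc) (even_iff_two_dvd.mpr (by exact_mod_cast h))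
  have hC2 : padicValNat 2 W.tamagawaProduct = 0 :=
    padicValNat.eq_zero_of_not_dvd fun h ↦ (Nat.not_even_iff_odd.mpr hT) (even_iff_two_dvd.mpr h)
  rw [hone, hc2, hC2, add_zero, mul_zero, pow_zero, mul_one] at hexact
  -- `1 = 2^(2M₀)` forces `M₀ = 0`
  have h := Nat.pow_right_injective (le_refl 2) ((pow_zero 2).trans hexact)
  omega

/-! ## §2 Contrapositive: a door-open budget frame of positive depth refutes BSD₂ for the pair -/

/-- **A DOOR-OPEN budget frame with an odd-`c` datum whose `P(1)` has depth `≥ 1` REFUTES `BSD₂(W) ∧ BSD₂(Wd)`** (same frame as §1) — the falsifier shape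
behind FRAME♮'s door-open disjunct: on the U₂ cell (`r_an = 1`, `#Sel₂(W) = 2`, `C(W)` odd, `ρ̄₂` onto), computing `y_K mod 2W(K)` at door-open budget
frames tests BSD₂ of the pair.  CONDITIONAL on the PRINT facts; nothing about BSD is proved. [cite: GrossZagier1986, V.§2 (2.2)] [cite: MazurRubin2010, Cor. 3.4 (i)] -/
theorem not_bsdp_pair_of_doorOpen_of_one_le_depth
    (hGZ : ∀ (N : ℕ) [NeZero N] (W : WeierstrassCurve ℚ) (K : Type) [Field K] [NumberField K], gross_zagier N W K)
    (hGZK : rank_eq_analyticRank_of_analyticRank_le_one) (hmod : hasEntireLFunction_rat)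
    (hMilneC : Milne1972.bsdQuotient_baseChange_quadratic_anyModel)
    (W : WeierstrassCurve ℚ) [W.IsElliptic] [W.IsGloballyMinimal] [NeZero (W.conductorNorm ℤ)]
    (hr : W.analyticRank = 1) (hSel : Nat.card (W.selmerGroup 2) = 2) (hT : Odd W.tamagawaProduct) (hs2 : W.HasSurjectiveModNGaloisRep 2)
    (K : Type) [Field K] [NumberField K] (hK : IsImaginaryQuadratic K) (hodd : Odd (NumberField.discr K))
    (h3 : NumberField.discr K ≠ -3) (hH : SatisfiesHeegnerHypothesis (W.conductorNorm ℤ) K)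
    (Dt : ModularParametrizationData W (W.conductorNorm ℤ)) (hc : Odd Dt.c) (β : ℤ) (ι : K →+* ℂ) (d₁ : KolyvaginHeegnerData Dt β ι 1)
    (hy : ¬ IsOfFinAddOrder d₁.derivedPoint) (M₀ : ℕ) (hM₀ : 1 ≤ M₀)
    (hdiv : ∃ Q : (W.baseChange (ringClassField K ι 1)).toAffine.Point, ((2 ^ M₀ : ℕ) : ℤ) • Q = d₁.derivedPoint)
    (hndiv : ¬ ∃ Q : (W.baseChange (ringClassField K ι 1)).toAffine.Point, ((2 ^ (M₀ + 1) : ℕ) : ℤ) • Q = d₁.derivedPoint)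
    (Wd : WeierstrassCurve ℚ) [Wd.IsElliptic] [Wd.IsGloballyMinimal] (Cd : VariableChange ℚ)
    (hWd : Cd • W.quadraticTwist (NumberField.discr K : ℚ) = Wd) (hSel1 : Nat.card (Wd.selmerGroup 2) = 1)
    (hbudget : (W.Δ < 0 ∧ padicValNat 2 Wd.tamagawaProduct ≤ 1) ∨ padicValNat 2 Wd.tamagawaProduct = 0) :
    ¬ (BSDp W 2 ∧ BSDp Wd 2) := by
  rintro ⟨hBW, hBd⟩
  have h0 := depth_eq_zero_of_doorOpen_of_bsdp_pair hGZ hGZK hmod hMilneC W hr hSel hT hs2 K hK hodd h3 hH Dt hc β ι d₁ hy M₀ hdiv hndiv Wd Cd hWd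
    hSel1 hbudget hBW hBd
  omega

end Summit.BirchSwinnertonDyer.BirchSwinnertonDyer.Theorems.GenusExact.TwinSwap.TwinAnnihilation

end
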